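import Mathlib
import HarnessLib
import Summits.HubbardSuperconductivity.HubbardSuperconductivity.Theorems.KLProgrammeCooperVertexBlocks
import Summits.HubbardSuperconductivity.HubbardSuperconductivity.Theorems.KLProgrammeCooperVertexBlocksD4

/-!
# Route `KLProgramme` — D2 companion III: the model's Cooper operator is controlled block by block

Cell gate-hubbard-kl, seat p3.  Puts the two companions together for the finite-volume instance of
`KLProgrammeCooperVertexBlocksDefs.lean`:

* `inner_d4PermRep` — the permutation representation of `D₄` on `ℓ²((ℤ/Lℤ)²)` is unitary
  (`⟪ρ_g x, y⟫ = ⟪x, ρ_{g⁻¹} y⟫`), so together with `d4PermRep_one` / `d4PermRep_mul` ALL of the Schur machinery of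
  `KLProgrammeCooperVertexBlocksD4.lean` applies to it: the five channel subspaces are orthogonal and exhaust `ℓ²`;
* `channelFormInf_le_re_inner`, `le_formInf_of_forall_channelFormInf` (generic) — a common lower bound of the five
  numbers `channelFormInf ρ A χ` is a lower bound of `formInf A` for `A` commuting with a unitary representation;
* **`le_formInf_klCooperOp`** — for the countertermed effective action at any scale `Λ` and volume: if every channel
  bottom `klScaleBlockInf L M β U μ K Λ χ` is `≥ c`, then the whole Cooper operator's form is `≥ c`.  This is the
  reassembly step of DECOMP App. E Lemma E.4: C2's per-block envelopes (`blockFlow_envelopes`, run on each `blockOp`)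
  give back a bound on the full Cooper-channel quartic kernel, the input of BGM's `(2.71a)`.

References: HOME/DECOMP.md v7 §2 C2, App. E Lemma E.4.
-/

noncomputable section

namespace Summit.HubbardSuperconductivity.HubbardSuperconductivity.Theorems.CooperVertexBlocks

set_option linter.dupNamespace false -- summit = problem name (single-conjunct summit), D-0017

open scoped InnerProductSpace
open RCLike Literature.MathematicalPhysics.QuantumLattice Literature.Probability.LatticeModels
open Summit.HubbardSuperconductivity.HubbardSuperconductivity.Theorems.CooperChannelRiccatiFlow

/-! ## Generic: channel bottoms bound the whole form -/

section Generic

variable {E : Type*} [NormedAddCommGroup E] [InnerProductSpace ℂ E] {ρ : DihedralGroup 4 → E →L[ℂ] E}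

/-- The channel bottom is below the form at every unit vector of the channel. -/
theorem channelFormInf_le_re_inner (A : E →L[ℂ] E) (χ : D4Irrep) {w : E} (hw : ‖w‖ = 1)
    (hwχ : isotypicProj ρ χ w = w) : channelFormInf ρ A χ ≤ re ⟪w, A w⟫_ℂ := by
  refine csInf_le ⟨-‖A‖, ?_⟩ ⟨w, ⟨hw, hwχ⟩, rfl⟩
  rintro _ ⟨v, ⟨hv, -⟩, rfl⟩
  exact neg_le_of_abs_le (abs_re_inner_apply_le_norm A hv)

/-- **Block-by-block control of the form:** for a unitary representation `ρ` (`ρ 1 = 1`, multiplicative,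
`⟪ρ_g x, y⟫ = ⟪x, ρ_{g⁻¹} y⟫`) and an operator `A` commuting with it, a common lower bound `c` of the five channel bottoms
`channelFormInf ρ A χ` is a lower bound of `formInf A`. -/
theorem le_formInf_of_forall_channelFormInf [Nontrivial E] (hρ : ∀ g h, ρ (g * h) = ρ g * ρ h) (h1 : ρ 1 = 1)
    (hadj : ∀ g (x y : E), ⟪ρ g x, y⟫_ℂ = ⟪x, ρ g⁻¹ y⟫_ℂ) {A : E →L[ℂ] E} (hA : ∀ g, A * ρ g = ρ g * A) {c : ℝ}
    (hc : ∀ χ, c ≤ channelFormInf ρ A χ) : c ≤ formInf A :=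
  le_formInf_of_forall_channel hρ h1 hadj hA fun χ _ hw hwχ => (hc χ).trans (channelFormInf_le_re_inner A χ hw hwχ)

end Generic

/-! ## The finite-volume permutation representation is unitary -/

section FiniteVolume

variable (L M : ℕ) [NeZero L]

/-- `ρ_g ρ_{g⁻¹} = 1` for the permutation representation. -/
theorem d4PermRep_mul_inv (g : DihedralGroup 4) : d4PermRep L g * d4PermRep L g⁻¹ = 1 := by
  rw [← d4PermRep_mul, mul_inv_cancel, d4PermRep_one]

/-- **The permutation representation of `D₄` on `ℓ²((ℤ/Lℤ)²)` is unitary:** `⟪ρ_g x, y⟫ = ⟪x, ρ_{g⁻¹} y⟫`. -/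
theorem inner_d4PermRep (g : DihedralGroup 4) (x y : EuclideanSpace ℂ (TorusSite 2 L)) :
    ⟪d4PermRep L g x, y⟫_ℂ = ⟪x, d4PermRep L g⁻¹ y⟫_ℂ := by
  have hy : d4PermRep L g (d4PermRep L g⁻¹ y) = y := by
    have h := congrArg (fun S : EuclideanSpace ℂ (TorusSite 2 L) →L[ℂ] EuclideanSpace ℂ (TorusSite 2 L) => S y)
      (d4PermRep_mul_inv L g)
    exact h
  conv_lhs => rw [← hy]
  exact (LinearIsometryEquiv.piLpCongrLeft 2 ℂ ℂ (d4SitePerm (L := L) g)).inner_map_map x _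

variable [NeZero M]

/-- **The model's Cooper operator is controlled block by block:** for the countertermed effective action at scale `Λ`
(seed `0`, frame `K`, band `e_K`), a common lower bound of the five channel bottoms `klScaleBlockInf L M β U μ K Λ χ` bounds
the form of the full Cooper operator from below (and trivially each nonempty channel bottom is `≥ formInf`). -/
theorem le_formInf_klCooperOp (β U μ : ℝ) (K : TrigPolyC4v) (Λ : ℝ) {c : ℝ}
    (hc : ∀ χ, c ≤ klScaleBlockInf L M β U μ K Λ χ) :
    c ≤ formInf (cooperOp L M β (nambuXiCT L μ K) Λ (hubbardEffectiveActionCT L M β U μ 0 K Λ)) := by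
  haveI : Nontrivial (EuclideanSpace ℂ (TorusSite 2 L)) := by
    haveI : Nonempty (TorusSite 2 L) := ⟨fun _ => 0⟩
    infer_instance
  exact le_formInf_of_forall_channelFormInf (d4PermRep_mul L) (d4PermRep_one L) (inner_d4PermRep L)
    (fun g => cooperOp_hubbardEffectiveActionCT_comm L M β U μ K Λ g) hc

end FiniteVolume

/-! ## Channel bottoms are 1-Lipschitz in the operator (the Lean face of C3's bookkeeping) -/

section Lipschitz

variable {E : Type*} [NormedAddCommGroup E] [InnerProductSpace ℂ E] {ρ : DihedralGroup 4 → E →L[ℂ] E} {χ : D4Irrep}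

/-- `A - B` leaves the channel invariant when `A`, `B` do. -/
theorem mapsTo_sub (A : E →L[ℂ] E) (hA : ∀ v ∈ channelSubspace ρ χ, A v ∈ channelSubspace ρ χ) (B : E →L[ℂ] E)
    (hB : ∀ v ∈ channelSubspace ρ χ, B v ∈ channelSubspace ρ χ) :
    ∀ v ∈ channelSubspace ρ χ, (A - B) v ∈ channelSubspace ρ χ :=
  fun v hv => Submodule.sub_mem _ (hA v hv) (hB v hv)

/-- **Channel bottoms move by at most the operator norm of the perturbation:**
`|channelFormInf ρ A χ - channelFormInf ρ B χ| ≤ ‖A - B‖` for `A`, `B` leaving the channel invariant — so each of the four C3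
differences (thermal, infrared tail, counterterm frame, frequency; HOME/p3/C3-NOTE.md §3) shifts every block bottom by at most
its operator norm. -/
theorem abs_channelFormInf_sub_le (A : E →L[ℂ] E) (hA : ∀ v ∈ channelSubspace ρ χ, A v ∈ channelSubspace ρ χ)
    (B : E →L[ℂ] E) (hB : ∀ v ∈ channelSubspace ρ χ, B v ∈ channelSubspace ρ χ) :
    |channelFormInf ρ A χ - channelFormInf ρ B χ| ≤ ‖A - B‖ := by
  rw [← formInf_blockOp A hA, ← formInf_blockOp B hB]
  have h : blockOp ρ χ A hA = blockOp ρ χ B hB + blockOp ρ χ (A - B) (mapsTo_sub A hA B hB) := by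
    apply ContinuousLinearMap.ext
    intro v
    apply Subtype.ext
    show A v = B v + (A - B) v
    simp
  rw [h]
  exact (abs_formInf_add_sub_le _ _).trans (norm_blockOp_le _ _)

/-- The same for the channel tops. -/
theorem abs_channelFormSup_sub_le (A : E →L[ℂ] E) (hA : ∀ v ∈ channelSubspace ρ χ, A v ∈ channelSubspace ρ χ)
    (B : E →L[ℂ] E) (hB : ∀ v ∈ channelSubspace ρ χ, B v ∈ channelSubspace ρ χ) :
    |channelFormSup ρ A χ - channelFormSup ρ B χ| ≤ ‖A - B‖ := by
  rw [← formSup_blockOp A hA, ← formSup_blockOp B hB]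
  have h : blockOp ρ χ A hA = blockOp ρ χ B hB + blockOp ρ χ (A - B) (mapsTo_sub A hA B hB) := by
    apply ContinuousLinearMap.ext
    intro v
    apply Subtype.ext
    show A v = B v + (A - B) v
    simp
  rw [h]
  exact (abs_formSup_add_sub_le _ _).trans (norm_blockOp_le _ _)

end Lipschitz

end Summit.HubbardSuperconductivity.HubbardSuperconductivity.Theorems.CooperVertexBlocks

end
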